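import Summits.BirchSwinnertonDyer.Rank1Residual.ManinAdditive.NeronFLineDepth
import Mathlib.LinearAlgebra.Isomorphisms
import Mathlib.Data.ZMod.QuotientRing
import HarnessLib

/-!
# Néron `f`-line bookkeeping: `|c| · #coker(ξ^*) · [e_f Λ : ℤ f] = deg φ` (imc PROP 29.AO as a theorem)

Cell bsd-f2-manin, prover seat p3 g17 (typer g21 pointer (c), 2026-08-29T20:01Z; imc MEMO-imc §35/§36 PROP 29.AO,
posited there as the interface axiom `NeronFormalInvariants.ao`).  Over the tree's posited Néron `f`-line datum
`Δ : NeronFLineDatum W D` (`NeronFLineDepth.lean`: `Λ`, `ξ^* : Λ → ℤ`, `κ`, `ξ^*(g)⟨f,f⟩ = κ⟨f,g⟩`, `κ·c = deg φ`)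
the three integers
* `s := Δ.lieSaturationIndex = #(ℤ ⧸ range ξ^*)` (Lie-saturation defect),
* `r := Δ.neronCongruenceNumber = lineIndex Λ f = #(Λ ⧸ (ℤf + Λ ∩ f^⊥))` (Néron congruence number),
* `c := D.maninConstant`, `deg φ := D.modularDegree`
satisfy, WHENEVER `f ∈ Λ`:  **`|c| · s · r = deg φ`** (`natAbs_maninConstant_mul_lieSaturationIndex_mul_neronCongruenceNumber`),
hence `v_p(c) + v_p(s) + v_p(r) = v_p(deg φ)` at every prime (PROP 29.AO, `padicVal_bookkeeping`); and whenever only a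
multiple `n•f ∈ Λ` (`n ≠ 0`): `|c| · s · r ∣ |n| · deg φ`, so `v_p(c) + v_p(s) + v_p(r) ≤ v_p(deg φ)` for `p ∤ n` — the
direction the Hasse–Witt criterion (imc COR 29.BH) consumes.  Mechanism: `ξ^* = κ·(f-coordinate)`, so
`Λ ⧸ (ℤf + Λ∩f^⊥) ≅ range(ξ^* mod ξ^*(f))` and `#(ℤ/ξ^*(f)ℤ) = #range(ξ^* mod ξ^*(f)) · #(ℤ/range ξ^*)` (third
isomorphism theorem), with `ξ^*(f) = κ`, `κ c = deg φ`.  Pure bookkeeping on the interface: NO Néron-model input,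
nothing asserted about the true Néron lattice.  BSD is not proved by this; Manin's conjecture is not proved by this.
-/

set_option autoImplicit false
set_option linter.dupNamespace false

namespace Summit.BirchSwinnertonDyer.BirchSwinnertonDyer.Theorems.ManinLocalTwoThree.NeronFLineBookkeeping

open scoped MatrixGroups ModularForm
open CongruenceSubgroup Literature.NumberTheory.EllipticCurves.ModularForms
open Summit.BirchSwinnertonDyer.Rank1Residual.ManinAdditive

variable {N : ℕ} [NeZero N] {W : WeierstrassCurve ℚ} [W.IsElliptic] {D : ModularParametrizationData W N}
  (Δ : NeronFLineDatum W D)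

/-! ### §1. `ξ^*` vanishes exactly on `Λ ∩ f^⊥` -/

/-- `κ ≠ 0` (`κ · c = deg φ > 0`). [folklore] -/
theorem κ_ne_zero : Δ.κ ≠ 0 := by
  intro h0
  have h := Δ.κ_mul_maninConstant
  rw [h0, zero_mul] at h
  exact (Nat.cast_ne_zero.mpr D.deg_pos.ne') h.symm

/-- `ξ^*(g) = 0 ⟺ ⟨f, g⟩ = 0` (from `ξ^*(g)⟨f,f⟩ = κ⟨f,g⟩`, `κ ≠ 0`, `⟨f,f⟩ ≠ 0`). [folklore] -/
theorem xiStar_eq_zero_iff (g : Δ.Λ) :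
    Δ.xiStar g = 0 ↔ peterssonProduct (Gamma0 N) 2 D.f (g : CuspForm (Gamma0 N) 2) = 0 := by
  have h := Δ.xiStar_mul g
  have hκ : (Δ.κ : ℂ) ≠ 0 := by exact_mod_cast (κ_ne_zero Δ)
  constructor
  · intro h0
    rw [h0, Int.cast_zero, zero_mul] at h
    exact (mul_eq_zero.mp h.symm).resolve_left hκ
  · intro h0
    rw [h0, mul_zero] at h
    exact_mod_cast (mul_eq_zero.mp h).resolve_right Δ.petersson_self_ne_zero

/-- `ξ^*(n•f) · c = n · deg φ` for any multiple `n•f ∈ Λ` (`ξ^*(n f) = κ n`, `κ c = deg φ`). [folklore] -/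
theorem xiStar_smul_self_mul_maninConstant {n : ℤ} (hn : n • D.f ∈ Δ.Λ) :
    Δ.xiStar ⟨n • D.f, hn⟩ * D.maninConstant = n * D.modularDegree := by
  have hq : ((n : ℚ) : ℂ) * peterssonProduct (Gamma0 N) 2 D.f D.f =
      peterssonProduct (Gamma0 N) 2 D.f ((⟨n • D.f, hn⟩ : Δ.Λ) : CuspForm (Gamma0 N) 2) := by
    have e : ((⟨n • D.f, hn⟩ : Δ.Λ) : CuspForm (Gamma0 N) 2) = ((n : ℂ)) • D.f := by
      simp [Int.cast_smul_eq_zsmul]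
    rw [e, peterssonProduct_smul_right]
    push_cast
    ring
  have h1 := Δ.xiStar_eq_of_coord hq
  have h2 := Δ.κ_mul_maninConstant
  have h3 : ((Δ.xiStar ⟨n • D.f, hn⟩ * D.maninConstant : ℤ) : ℚ) = ((n * D.modularDegree : ℤ) : ℚ) := by
    push_cast
    rw [h1, ← h2]
    ring
  exact_mod_cast h3

/-! ### §2. The `f`-line quotient `Λ ⧸ (ℤf + Λ ∩ f^⊥)` through `ξ^*` -/

/-- For a multiple `n•f ∈ Λ`: every `g ∈ Λ` with `ξ^*(n f) ∣ ξ^*(g)` lies in `ℤ f + Λ ∩ f^⊥`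
(`g = t n f + (g − t n f)`, the second summand killed by `ξ^*`, hence `f`-orthogonal). [folklore] -/
theorem ker_le_fLine {n : ℤ} (hn : n • D.f ∈ Δ.Λ) :
    LinearMap.ker ((Submodule.span ℤ {Δ.xiStar ⟨n • D.f, hn⟩}).mkQ ∘ₗ Δ.xiStar) ≤
      ((ℤ ∙ D.f) ⊔ (Δ.Λ ⊓ (LinearMap.ker (peterssonProductₗ (Gamma0 N) 2 D.f)).restrictScalars ℤ)).comap
        Δ.Λ.subtype := by
  intro g hg
  rw [LinearMap.mem_ker, LinearMap.comp_apply, Submodule.mkQ_apply, Submodule.Quotient.mk_eq_zero,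
    Submodule.mem_span_singleton] at hg
  obtain ⟨t, ht⟩ := hg
  have hmem : (g : CuspForm (Gamma0 N) 2) - (t * n) • D.f ∈ Δ.Λ := by
    rw [mul_smul]
    exact Δ.Λ.sub_mem g.2 (Δ.Λ.smul_mem t hn)
  have hx : Δ.xiStar ⟨_, hmem⟩ = 0 := by
    have e : (⟨(g : CuspForm (Gamma0 N) 2) - (t * n) • D.f, hmem⟩ : Δ.Λ) = g - t • ⟨n • D.f, hn⟩ := by
      apply Subtype.ext
      simp [mul_smul]
    rw [e, map_sub, map_smul, ← ht, sub_self]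
  rw [Submodule.mem_comap, Submodule.subtype_apply, Submodule.mem_sup]
  refine ⟨(t * n) • D.f, Submodule.mem_span_singleton.mpr ⟨t * n, rfl⟩,
    (g : CuspForm (Gamma0 N) 2) - (t * n) • D.f, Submodule.mem_inf.mpr ⟨hmem, ?_⟩, by abel⟩
  rw [Submodule.restrictScalars_mem, LinearMap.mem_ker, peterssonProductₗ_apply]
  exact ((xiStar_eq_zero_iff Δ) ⟨_, hmem⟩).mp hx

/-- For `f ∈ Λ` the converse: `ℤ f + Λ ∩ f^⊥` is EXACTLY the set of `g ∈ Λ` with `ξ^*(f) ∣ ξ^*(g)`. [folklore] -/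
theorem fLine_le_ker (hf : D.f ∈ Δ.Λ) :
    ((ℤ ∙ D.f) ⊔ (Δ.Λ ⊓ (LinearMap.ker (peterssonProductₗ (Gamma0 N) 2 D.f)).restrictScalars ℤ)).comap
        Δ.Λ.subtype ≤
      LinearMap.ker ((Submodule.span ℤ {Δ.xiStar ⟨(1 : ℤ) • D.f, by rwa [one_smul]⟩}).mkQ ∘ₗ Δ.xiStar) := by
  intro g hg
  rw [Submodule.mem_comap, Submodule.subtype_apply, Submodule.mem_sup] at hg
  obtain ⟨y, hy, z, hz, hyz⟩ := hg
  obtain ⟨t, rfl⟩ := Submodule.mem_span_singleton.mp hy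
  obtain ⟨hzΛ, hzker⟩ := Submodule.mem_inf.mp hz
  rw [Submodule.restrictScalars_mem, LinearMap.mem_ker, peterssonProductₗ_apply] at hzker
  have hz0 : Δ.xiStar ⟨z, hzΛ⟩ = 0 := ((xiStar_eq_zero_iff Δ) ⟨z, hzΛ⟩).mpr hzker
  have hf1 : (1 : ℤ) • D.f ∈ Δ.Λ := by rwa [one_smul]
  have e : g = t • ⟨(1 : ℤ) • D.f, hf1⟩ + ⟨z, hzΛ⟩ := by
    apply Subtype.ext
    simp [← hyz]
  rw [LinearMap.mem_ker, LinearMap.comp_apply, Submodule.mkQ_apply, Submodule.Quotient.mk_eq_zero,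
    Submodule.mem_span_singleton]
  exact ⟨t, by rw [e, map_add, map_smul, hz0, add_zero]⟩

/-! ### §3. Cardinalities: `s · #(Λ ⧸ ker) = |ξ^*(n f)|` by the third isomorphism theorem in `ℤ` -/

/-- `#(ℤ ⧸ range ξ^*) · #(Λ ⧸ {g : ξ^*(nf) ∣ ξ^*(g)}) = |ξ^*(n f)|`. [folklore] -/
theorem lieSaturationIndex_mul_card_quotient_ker {n : ℤ} (hn : n • D.f ∈ Δ.Λ) :
    Δ.lieSaturationIndex *
        Nat.card (Δ.Λ ⧸ LinearMap.ker ((Submodule.span ℤ {Δ.xiStar ⟨n • D.f, hn⟩}).mkQ ∘ₗ Δ.xiStar)) =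
      (Δ.xiStar ⟨n • D.f, hn⟩).natAbs := by
  set κ' : ℤ := Δ.xiStar ⟨n • D.f, hn⟩ with hκ'
  set ψ := (Submodule.span ℤ {κ'}).mkQ ∘ₗ Δ.xiStar with hψ
  have hle : Submodule.span ℤ {κ'} ≤ LinearMap.range Δ.xiStar :=
    (Submodule.span_singleton_le_iff_mem _ _).mpr ⟨⟨n • D.f, hn⟩, rfl⟩
  have h3 := Submodule.card_quotient_mul_card_quotient (LinearMap.range Δ.xiStar) (Submodule.span ℤ {κ'}) hle
  have hrange : (LinearMap.range Δ.xiStar).map (Submodule.span ℤ {κ'}).mkQ = LinearMap.range ψ := by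
    rw [hψ, LinearMap.range_comp]
  have hcardZ : Nat.card (ℤ ⧸ Submodule.span ℤ {κ'}) = κ'.natAbs := by
    rw [Nat.card_congr (Int.quotientSpanEquivZMod κ').toEquiv, Nat.card_zmod]
  rw [hrange, hcardZ, Nat.card_congr (LinearMap.quotKerEquivRange ψ).toEquiv.symm] at h3
  rw [← h3, mul_comm]
  rfl

/-! ### §4. PROP 29.AO as a theorem -/

/-- **`|c| · s · r = deg φ` when `f ∈ Λ`** (`s = Δ.lieSaturationIndex`, `r = Δ.neronCongruenceNumber`). [folklore] -/
theorem natAbs_maninConstant_mul_lieSaturationIndex_mul_neronCongruenceNumber (hf : D.f ∈ Δ.Λ) :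
    D.maninConstant.natAbs * Δ.lieSaturationIndex * Δ.neronCongruenceNumber = D.modularDegree := by
  have hf1 : (1 : ℤ) • D.f ∈ Δ.Λ := by rwa [one_smul]
  have hker : LinearMap.ker ((Submodule.span ℤ {Δ.xiStar ⟨(1 : ℤ) • D.f, hf1⟩}).mkQ ∘ₗ Δ.xiStar) =
      ((ℤ ∙ D.f) ⊔ (Δ.Λ ⊓ (LinearMap.ker (peterssonProductₗ (Gamma0 N) 2 D.f)).restrictScalars ℤ)).comap
        Δ.Λ.subtype :=
    le_antisymm ((ker_le_fLine Δ) hf1) ((fLine_le_ker Δ) hf)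
  have h1 := (lieSaturationIndex_mul_card_quotient_ker Δ) hf1
  rw [hker] at h1
  have h2 := (xiStar_smul_self_mul_maninConstant Δ) hf1
  rw [one_mul] at h2
  have h3 : (Δ.xiStar ⟨(1 : ℤ) • D.f, hf1⟩).natAbs * D.maninConstant.natAbs = D.modularDegree := by
    rw [← Int.natAbs_mul, h2, Int.natAbs_natCast]
  rw [mul_comm D.maninConstant.natAbs, mul_assoc, mul_comm D.maninConstant.natAbs, ← mul_assoc]
  show Δ.lieSaturationIndex * Nat.card (Δ.Λ ⧸ _) * D.maninConstant.natAbs = D.modularDegree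
  rw [h1, h3]

/-- **`|c| · s · r ∣ |n| · deg φ` when only `n•f ∈ Λ`** (the `f`-line quotient is then a quotient of
`Λ ⧸ {ξ^*(nf) ∣ ξ^*}`). [folklore] -/
theorem natAbs_maninConstant_mul_lieSaturationIndex_mul_neronCongruenceNumber_dvd {n : ℤ}
    (hn : n • D.f ∈ Δ.Λ) :
    D.maninConstant.natAbs * Δ.lieSaturationIndex * Δ.neronCongruenceNumber ∣ n.natAbs * D.modularDegree := by
  set K := LinearMap.ker ((Submodule.span ℤ {Δ.xiStar ⟨n • D.f, hn⟩}).mkQ ∘ₗ Δ.xiStar) with hK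
  set F := ((ℤ ∙ D.f) ⊔ (Δ.Λ ⊓ (LinearMap.ker (peterssonProductₗ (Gamma0 N) 2 D.f)).restrictScalars ℤ)).comap
        Δ.Λ.subtype with hF
  have hdvd : Δ.neronCongruenceNumber ∣ Nat.card (Δ.Λ ⧸ K) := by
    have h := Submodule.card_quotient_mul_card_quotient F K ((ker_le_fLine Δ) hn)
    exact ⟨Nat.card (F.map K.mkQ), by rw [← h, mul_comm]; rfl⟩
  have h1 := (lieSaturationIndex_mul_card_quotient_ker Δ) hn
  have h2 := (xiStar_smul_self_mul_maninConstant Δ) hn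
  have h3 : (Δ.xiStar ⟨n • D.f, hn⟩).natAbs * D.maninConstant.natAbs = n.natAbs * D.modularDegree := by
    rw [← Int.natAbs_mul, h2, Int.natAbs_mul, Int.natAbs_natCast]
  calc D.maninConstant.natAbs * Δ.lieSaturationIndex * Δ.neronCongruenceNumber
      ∣ D.maninConstant.natAbs * Δ.lieSaturationIndex * Nat.card (Δ.Λ ⧸ K) := mul_dvd_mul_left _ hdvd
    _ = n.natAbs * D.modularDegree := by rw [mul_assoc, h1, mul_comm, h3]

/-- **PROP 29.AO (imc MEMO-imc §35/§36) AS A THEOREM: `v_p(c) + v_p(s) + v_p(r) = v_p(deg φ)` at every prime, for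
every Néron `f`-line datum with `f ∈ Λ`.** [folklore] -/
theorem padicVal_bookkeeping (hf : D.f ∈ Δ.Λ) (p : ℕ) [hp : Fact p.Prime] :
    padicValInt p D.maninConstant + padicValNat p Δ.lieSaturationIndex + padicValNat p Δ.neronCongruenceNumber =
      padicValNat p D.modularDegree := by
  have h := (natAbs_maninConstant_mul_lieSaturationIndex_mul_neronCongruenceNumber Δ) hf
  have hdeg : D.modularDegree ≠ 0 := D.deg_pos.ne'
  have hprod : D.maninConstant.natAbs * Δ.lieSaturationIndex * Δ.neronCongruenceNumber ≠ 0 := h ▸ hdeg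
  have hc : D.maninConstant.natAbs ≠ 0 := fun h0 => hprod (by rw [h0, zero_mul, zero_mul])
  have hs : Δ.lieSaturationIndex ≠ 0 := fun h0 => hprod (by rw [h0, mul_zero, zero_mul])
  have hr : Δ.neronCongruenceNumber ≠ 0 := fun h0 => hprod (by rw [h0, mul_zero])
  rw [← h, padicValNat.mul (mul_ne_zero hc hs) hr, padicValNat.mul hc hs, padicValInt]

/-- The `p`-LOCAL form: if some prime-to-`p` multiple `n•f` lies in `Λ`, then
`v_p(c) + v_p(s) + v_p(r) ≤ v_p(deg φ)` (and all three are finite: `c, s, r ≠ 0`). [folklore] -/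
theorem padicVal_bookkeeping_le {n : ℤ} (hn : n • D.f ∈ Δ.Λ) (hn0 : n ≠ 0) (p : ℕ) [hp : Fact p.Prime]
    (hpn : ¬ (p : ℤ) ∣ n) :
    padicValInt p D.maninConstant + padicValNat p Δ.lieSaturationIndex + padicValNat p Δ.neronCongruenceNumber ≤
      padicValNat p D.modularDegree := by
  have h := (natAbs_maninConstant_mul_lieSaturationIndex_mul_neronCongruenceNumber_dvd Δ) hn
  have hdeg : D.modularDegree ≠ 0 := D.deg_pos.ne'
  have hnd : n.natAbs * D.modularDegree ≠ 0 := mul_ne_zero (Int.natAbs_ne_zero.mpr hn0) hdeg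
  have hprod : D.maninConstant.natAbs * Δ.lieSaturationIndex * Δ.neronCongruenceNumber ≠ 0 :=
    fun h0 => hnd (Nat.eq_zero_of_zero_dvd (h0 ▸ h))
  have hc : D.maninConstant.natAbs ≠ 0 := fun h0 => hprod (by rw [h0, zero_mul, zero_mul])
  have hs : Δ.lieSaturationIndex ≠ 0 := fun h0 => hprod (by rw [h0, mul_zero, zero_mul])
  have hr : Δ.neronCongruenceNumber ≠ 0 := fun h0 => hprod (by rw [h0, mul_zero])
  have hv := (padicValNat_dvd_iff_le (p := p) hnd).mp (dvd_trans (pow_padicValNat_dvd (p := p)) h)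
  rw [padicValNat.mul (mul_ne_zero hc hs) hr, padicValNat.mul hc hs,
    padicValNat.mul (Int.natAbs_ne_zero.mpr hn0) hdeg] at hv
  have hn' : padicValNat p n.natAbs = 0 := by
    rw [padicValNat.eq_zero_iff]
    right; right
    intro hd
    exact hpn (Int.natCast_dvd.mpr hd)
  rw [padicValInt]
  omega

/-! ### §5. Dictionary with the tree's GIVEN-datum predicates -/

/-- **`LieSaturatedAt p ⟺ p ∤ s`**: `ξ^* ⊗ ℤ₍ₚ₎` is onto iff `p` does not divide `#coker ξ^*` (`range ξ^* = dℤ`,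
`s = |d|`; `s = 0`, i.e. `ξ^* = 0`, is correctly «never saturated»). [folklore] -/
theorem lieSaturatedAt_iff_not_dvd (p : ℕ) [Fact p.Prime] :
    Δ.LieSaturatedAt p ↔ ¬ p ∣ Δ.lieSaturationIndex := by
  set Rg : Submodule ℤ ℤ := LinearMap.range Δ.xiStar with hRg
  haveI : Rg.IsPrincipal := IsPrincipalIdealRing.principal Rg
  set d : ℤ := Submodule.IsPrincipal.generator Rg with hd
  have hspan : Submodule.span ℤ {d} = Rg := Ideal.span_singleton_generator Rg
  have hs : Δ.lieSaturationIndex = d.natAbs := by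
    show Nat.card (ℤ ⧸ LinearMap.range Δ.xiStar) = d.natAbs
    rw [← hRg, Nat.card_congr (Submodule.quotEquivOfEq _ _ hspan.symm).toEquiv,
      Nat.card_congr (Int.quotientSpanEquivZMod d).toEquiv, Nat.card_zmod]
  rw [hs]
  constructor
  · rintro ⟨g, hg⟩ hpd
    apply hg
    have hmem : Δ.xiStar g ∈ Rg := ⟨g, rfl⟩
    obtain ⟨t, ht⟩ := (Submodule.IsPrincipal.mem_iff_eq_smul_generator Rg).mp hmem
    rw [ht, smul_eq_mul]
    exact dvd_mul_of_dvd_right (Int.natCast_dvd.mpr hpd) t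
  · intro hpd
    have hmem : d ∈ Rg := Submodule.IsPrincipal.generator_mem Rg
    obtain ⟨g, hg⟩ := hmem
    exact ⟨g, fun h => hpd (Int.natCast_dvd.mp (hg ▸ h))⟩

/-- **Depth read on the congruence number** (with `f ∈ Λ`): `NeronCongruenceDepthAt p ⟺ v_p(r) = v_p(deg φ)`
(the tree's COLLAPSE `depthAt_iff` + PROP 29.AO: `v_p(c) = v_p(s) = 0 ⟺ v_p(r) = v_p(deg φ)`). [folklore] -/
theorem depthAt_iff_padicValNat_neronCongruenceNumber_eq (hf : D.f ∈ Δ.Λ) (p : ℕ) [hp : Fact p.Prime] :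
    Δ.NeronCongruenceDepthAt p ↔ padicValNat p Δ.neronCongruenceNumber = padicValNat p D.modularDegree := by
  have h := (padicVal_bookkeeping Δ) hf p
  have hprod := (natAbs_maninConstant_mul_lieSaturationIndex_mul_neronCongruenceNumber Δ) hf
  have hdeg : D.modularDegree ≠ 0 := D.deg_pos.ne'
  have hne : D.maninConstant.natAbs * Δ.lieSaturationIndex * Δ.neronCongruenceNumber ≠ 0 := hprod ▸ hdeg
  have hc : D.maninConstant.natAbs ≠ 0 := fun h0 => hne (by rw [h0, zero_mul, zero_mul])
  have hs : Δ.lieSaturationIndex ≠ 0 := fun h0 => hne (by rw [h0, mul_zero, zero_mul])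
  have hcv : padicValInt p D.maninConstant = 0 ↔ ¬ (p : ℤ) ∣ D.maninConstant := by
    rw [padicValInt, padicValNat.eq_zero_iff, Int.natCast_dvd]
    constructor
    · rintro (h1 | h0 | hnd)
      · exact absurd h1 hp.out.one_lt.ne'
      · exact absurd h0 hc
      · exact hnd
    · exact fun hnd => Or.inr (Or.inr hnd)
  have hsv : padicValNat p Δ.lieSaturationIndex = 0 ↔ ¬ p ∣ Δ.lieSaturationIndex := by
    rw [padicValNat.eq_zero_iff]
    constructor
    · rintro (h1 | h0 | hnd)
      · exact absurd h1 hp.out.one_lt.ne'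
      · exact absurd h0 hs
      · exact hnd
    · exact fun hnd => Or.inr (Or.inr hnd)
  rw [Δ.depthAt_iff, lieSaturatedAt_iff_not_dvd, ← hcv, ← hsv]
  have h0 : 0 ≤ padicValInt p D.maninConstant := by positivity
  omega

end Summit.BirchSwinnertonDyer.BirchSwinnertonDyer.Theorems.ManinLocalTwoThree.NeronFLineBookkeeping
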